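import Summits.CriticalPhenomena.PercolationContinuityZ3.Theorems.Transplant.FKConnectivityAllQForestTransversal
import HarnessLib

/-!
# g20's chaining inequality Mono-Q as a node, and the telescoping reduction Mono-Q ⇒ (QS-∅) ⇒ D1 ⇒ (♣)⁰

Support file (`--supports stmt-CriticalPhenomena-4575`), FK sub-lane `prim-bschramm-fk-1` (generation 32) of the post-continuity
programme; builds on p205010 (kernel theorem, internal audit signed; external expert review pending).  One counting node (NOT asserted) with
its `Pos` form, theorems otherwise; no named facts, no sorries; standard axioms.

For `Y ⊆ Z ∌ w` the TWO-CLASS SURPLUS `s(Z,Y;w) := #(Fo ∩ T_Z, Fo ∩ T_{Y+w}) − #(Fo ∩ T_{Z+w}, Fo ∩ T_Y)` (`T_S` = `transvEv S` of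
`…ForestTransversal`) is the quantity of g20's QUOTIENT MONOTONICITY (QS-∅) (memo bschramm/FROM-fk-1-g20-SEPARATOR-EXCHANGE.md §3d; kernel
schema `hQ` of `…ForestQuotientMono`): (QS-∅) says `s ≥ 0`; `Y = {o}` is D1 = `ForestTransversalOn`, whose `Z = {o,v}` case is (♣)⁰.  g20 also
stated the CHAINING INEQUALITY **Mono-Q: `s(Z,Y;w) ≥ s(Z,Y ∪ {x};w)` for `x ∈ Z ∖ Y`** ("the surplus decreases along `G → G^w → … → G^W`,
where it is 0"; their evidence 0 / 6,918 random small instances).  THIS FILE: the node **`ForestMonoQOn V`** / `ForestMonoQPos` (NOT asserted) and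
the telescoping **`forest_quotientMono_of_monoQ`** (Mono-Q ⇒ (QS-∅) for all `Y ⊆ Z`, induction on `|Z ∖ Y|`, base `Y = Z` by the involution
`ω ↦ ω ∆ M`), **`forestTransversalOn_of_monoQ : ForestMonoQOn V → ForestTransversalOn V`**, **`adjForestRayleighNoSqOn_of_monoQ`**,
**`adjForestRayleighNoSqPos_of_monoQPos`**.  With `…ForestTransversalMono` this puts TWO independent local monotonicity nodes in the tree, each
implying (♣)⁰: MONO (g32: the first-class seed set `Z` grows by a NEIGHBOUR; base case a theorem) and Mono-Q (g20: the second-class seed set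
`Y` grows inside `Z`; base `Y = Z` by symmetry).
EVIDENCE for Mono-Q (g32 engine numerics32/dlr/dlr.c mode mq, exact, exhaustive, isomorph-free): all connected simple graphs n ≤ 9 (n = 8:
11,581,539 tests; n = 9: 230,212,995, kit j238997), all multigraphs with multiplicity ≤ 2 on ≤ 8 vertices (kit j238998/9: 5,107,545 + 118,247,717):
0 failures.  The two-class form of MONO (`s(Z,Y) ≥ s(Z∪{u},Y)`, `u ∈ N(Z)`) also has 0 failures through n = 8 (17,428,576 tests; kit j239009 = n 9).
[cite: SempleWelsh2008, Conj. 1.1 (p. 2); Thm. 4.2 (p. 11)] [cite: CibulkaHladkyLaCroixWagner2008, Thm. 1 (p. 2)] [cite: Linusson2011, Prop. 2.6]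
[cite: Grimmett2006, §1.5 (p. 13)]
-/

noncomputable section

namespace Summit.CriticalPhenomena.PercolationContinuityZ3.Theorems
namespace FK

open Set Literature.Probability.LatticeModels Literature.Probability.Percolation
open scoped Classical symmDiff

variable {V : Type*} [Fintype V]

/-! ### g20's chaining inequality Mono-Q: the two-class surplus is non-increasing in the second-class seed set -/

section MonoQ

/-- **The two-class surplus** `s(Z,Y;w) := #(Fo ∩ T_Z, Fo ∩ T_{Y ∪ {w}}) − #(Fo ∩ T_{Z ∪ {w}}, Fo ∩ T_Y)` is `≥ 0` for `Y ⊆ Z ∌ w` — this is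
g20's quotient monotonicity (QS-∅) (first class `Z`-transversal, second class `Y`-transversal: `w` hangs on `Z` in the first class at least as
often as on `Y` in the second); `Y = {o}` is D1.  **NODE Mono-Q `ForestMonoQOn V` (g20 §3d, NOT asserted): `s(Z,Y;w) ≥ s(Z,Y ∪ {x};w)`
for `x ∈ Z ∖ Y`**, additively.  EVIDENCE (g32 engine, exhaustive): all connected simple graphs n ≤ 9 (n = 9: 230,212,995 tests), all multigraphs
with multiplicity ≤ 2 on ≤ 8 vertices (118,247,717): 0 failures (g20: 0 / 6,918 random). [cite: SempleWelsh2008, Conj. 1.1 (p. 2)] [cite: Linusson2011, Prop. 2.6] -/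
def ForestMonoQOn (V : Type*) [Fintype V] : Prop :=
  ∀ (M u₀ : BondConfig V), Disjoint u₀ M → ∀ (Z Y : Finset V) (w x : V), Y ⊆ Z → w ∉ Z → x ∈ Z → x ∉ Y →
    fibreCount M u₀ (forestEv V ∩ transvEv Z) (forestEv V ∩ transvEv (insert w (insert x Y))) +
        fibreCount M u₀ (forestEv V ∩ transvEv (insert w Z)) (forestEv V ∩ transvEv Y) ≤
      fibreCount M u₀ (forestEv V ∩ transvEv Z) (forestEv V ∩ transvEv (insert w Y)) +
        fibreCount M u₀ (forestEv V ∩ transvEv (insert w Z)) (forestEv V ∩ transvEv (insert x Y))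

/-- **Mono-Q on every finite vertex type.**  CONJECTURE-SHAPED, NOT asserted. [cite: SempleWelsh2008, Conj. 1.1 (p. 2); Thm. 4.2 (p. 11)] -/
@[conjecture] def ForestMonoQPos : Prop := ∀ n : ℕ, ForestMonoQOn (Fin n)

/-- **Mono-Q ⇒ (QS-∅) for all `Y ⊆ Z`** (telescoping in `Y`; at `Y = Z` the surplus vanishes by the involution `ω ↦ ω ∆ M`).
[cite: SempleWelsh2008, Conj. 1.1 (p. 2)] [cite: Linusson2011, Prop. 2.6] -/
theorem forest_quotientMono_of_monoQ (h : ForestMonoQOn V) {M u₀ : BondConfig V} (hd : Disjoint u₀ M) :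
    ∀ (k : ℕ) (Z Y : Finset V) (w : V), (Z \ Y).card = k → Y ⊆ Z → w ∉ Z →
      fibreCount M u₀ (forestEv V ∩ transvEv (insert w Z)) (forestEv V ∩ transvEv Y) ≤
        fibreCount M u₀ (forestEv V ∩ transvEv Z) (forestEv V ∩ transvEv (insert w Y)) := by
  intro k
  induction k using Nat.strong_induction_on with
  | _ k ih =>
  intro Z Y w hk hYZ hwZ
  by_cases hx : ∃ x ∈ Z, x ∉ Y
  · obtain ⟨x, hxZ, hxY⟩ := hx
    have hm := h M u₀ hd Z Y w x hYZ hwZ hxZ hxY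
    have hlt : (Z \ insert x Y).card < k := by
      rw [← hk]
      refine Finset.card_lt_card ⟨fun a ha => ?_, fun hsub => ?_⟩
      · rw [Finset.mem_sdiff] at ha ⊢
        exact ⟨ha.1, fun ha' => ha.2 (Finset.mem_insert_of_mem ha')⟩
      · have : x ∈ Z \ insert x Y := hsub (Finset.mem_sdiff.2 ⟨hxZ, hxY⟩)
        exact (Finset.mem_sdiff.1 this).2 (Finset.mem_insert_self x Y)
    have hih := ih _ hlt Z (insert x Y) w rfl (Finset.insert_subset hxZ hYZ) hwZ
    omega
  · -- `Y = Z`: both sides are equal by the involution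
    push Not at hx
    have hZY : Z = Y := Finset.Subset.antisymm (fun a ha => hx a ha) hYZ
    subst hZY
    rw [fibreCount_swap M u₀ (forestEv V ∩ transvEv (insert w Z))]

/-- **Mono-Q ⇒ D1: `ForestMonoQOn V → ForestTransversalOn V`** (the instance `Y = {o}` of the previous theorem; `T_{o,w}` in the second class
is `o ≁ w`).  Hence Mono-Q ⇒ (♣)⁰ as well — a second local monotonicity node implying the square-free adjacent forest Rayleigh node, independent of MONO.
[cite: SempleWelsh2008, Conj. 1.1 (p. 2)] [cite: Linusson2011, Prop. 2.6] -/
theorem forestTransversalOn_of_monoQ (h : ForestMonoQOn V) : ForestTransversalOn V := by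
  intro M u₀ hd Z o w hoZ hwZ
  have how : o ≠ w := fun h' => hwZ (h' ▸ hoZ)
  have key := forest_quotientMono_of_monoQ h hd _ Z {o} w rfl (Finset.singleton_subset_iff.2 hoZ) hwZ
  calc fibreCount M u₀ (forestEv V ∩ transvEv (insert w Z)) (forestEv V)
      = fibreCount M u₀ (forestEv V ∩ transvEv (insert w Z)) (forestEv V ∩ transvEv ({o} : Finset V)) :=
        fibreCount_congr_fibre M u₀ fun ω _ => by
          constructor
          · rintro ⟨hA, hB⟩; exact ⟨hA, hB, mem_transvEv_singleton⟩
          · rintro ⟨hA, hB, -⟩; exact ⟨hA, hB⟩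
    _ ≤ fibreCount M u₀ (forestEv V ∩ transvEv Z) (forestEv V ∩ transvEv (insert w ({o} : Finset V))) := key
    _ = fibreCount M u₀ (forestEv V ∩ transvEv Z) (forestEv V ∩ (reachEv o w)ᶜ) :=
        fibreCount_congr_fibre M u₀ fun ω _ => by
          rw [mem_inter_iff, mem_inter_iff, mem_transvEv_pair (Ne.symm how)]
          constructor
          · rintro ⟨hA, hB, hs⟩; exact ⟨hA, hB, fun hr => hs hr.symm⟩
          · rintro ⟨hA, hB, hs⟩; exact ⟨hA, hB, fun hr => hs hr.symm⟩

/-- **`ForestMonoQOn V → AdjForestRayleighNoSqOn V`.** [cite: SempleWelsh2008, Conj. 1.1 (p. 2)] [cite: Linusson2011, Prop. 2.6] -/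
theorem adjForestRayleighNoSqOn_of_monoQ (h : ForestMonoQOn V) : AdjForestRayleighNoSqOn V :=
  adjForestRayleighNoSqOn_of_forestTransversal (forestTransversalOn_of_monoQ h)

/-- **`ForestMonoQPos → AdjForestRayleighNoSqPos`.** [cite: SempleWelsh2008, Conj. 1.1 (p. 2)] [cite: Grimmett2006, Thm. 3.8 (p. 43)] -/
theorem adjForestRayleighNoSqPos_of_monoQPos (h : ForestMonoQPos) : AdjForestRayleighNoSqPos :=
  fun n => adjForestRayleighNoSqOn_of_monoQ (h n)

end MonoQ

end FK
end Summit.CriticalPhenomena.PercolationContinuityZ3.Theorems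

end
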